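import Literature.NumberTheory.Automorphic.CDTTheorem712ConductorStepProofs
import HarnessLib

/-!
# Conrad–Diamond–Taylor 1999, Theorem 7.2.4: the decomposition record (`CDT_theorem_7_2_4_holds_of`)

Topic `Literature/NumberTheory/Automorphic`. Decomposition (librarian `fact-decompose`, 2026-08-16)
of the XL named fact `Literature.NumberTheory.Automorphic.BCDT.CDT_theorem_7_2_4`
(`BCDTModularity.lean`; Conrad–Diamond–Taylor, JAMS 12 (1999), Thm. 7.2.4, p. 556: "If `ρ̄_{E,5}` is
modular or `ρ̄_{E,5}|_{ℚ(√5)}` is not absolutely irreducible, then `E` is modular") into the two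
printed theorems of which the source records it as an immediate consequence ("we record the
following strengthening of Theorem 7.2.2, immediate from Theorem 7.1.2", p. 556):

* `CDT_theorem_7_1_2` (Thm. 7.1.2, p. 551 = the Theorem of CDT's Introduction: every `E/ℚ` of
  conductor not divisible by `27` is modular — Wiles, Taylor–Wiles, Diamond, CDT);
* `CDT_theorem_7_2_2` (Thm. 7.2.2, p. 553: `ρ̄_{E,5}|_{ℚ(√5)}` absolutely irreducible and `ρ̄_{E,5}`
  modular ⇒ `E` modular).

Both children are EXISTING named facts of `BCDTModularity.lean` (Part 4); no new fact is introduced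
here. The assembly `CDT_theorem_7_2_4_holds_of` is the tree's proved
`CDT_theorem_7_2_4_of_CDT712_722` (`CDTTheorem712ConductorStepProofs.lean`: the hidden step
"`ρ̄|_{ℚ(√5)}` not absolutely irreducible ⇒ image of order prime to `3` ⇒ `27 ∤ N_E`" is proved there,
with Ogg's formula at `3` discharged). For the record, the deeper printed leaves of Thm. 7.1.2 are
`CDT_theorem_7_2_1`, `CDT_theorem_7_2_2`, `CDT_lemma_7_2_3_isModular`, `CDT_three_five_switch`
(`CDT_theorem_7_1_2_of_CDT721_722_723_switch`), whence `CDT_theorem_7_2_4_holds_of_leaves` below.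
Theorems only; no definition, no named fact.

## References

* B. Conrad, F. Diamond, R. Taylor, *Modularity of certain potentially Barsotti–Tate Galois
  representations*, J. Amer. Math. Soc. 12 (1999) 521–567: Thm. 7.1.2 (p. 551), Thm. 7.2.1,
  Thm. 7.2.2 (p. 553), Lemma 7.2.3 (p. 554), Thm. 7.2.4 (p. 556). [ConradDiamondTaylor1999]
-/

namespace Literature.NumberTheory.Automorphic.BCDT

/-- **CDT Thm. 7.2.4 from its printed inputs Thm. 7.1.2 and Thm. 7.2.2** (JAMS 12 (1999), p. 556:
"immediate from Theorem 7.1.2"): the decomposition assembly of the named fact `CDT_theorem_7_2_4`,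
i.e. the tree's `CDT_theorem_7_2_4_of_CDT712_722`. [cite: ConradDiamondTaylor1999, Thm. 7.2.4 (p. 556)] -/
theorem CDT_theorem_7_2_4_holds_of :
    CDT_theorem_7_1_2 → CDT_theorem_7_2_2 → CDT_theorem_7_2_4 :=
  CDT_theorem_7_2_4_of_CDT712_722

/-- **CDT Thm. 7.2.4 from the deeper printed leaves** Thm. 7.2.1, Thm. 7.2.2, Lemma 7.2.3
(modularity conclusion) and the `3`–`5` switch of p. 556 (the tree's
`CDT_theorem_7_2_4_of_CDT721_722_723_switch`). [cite: ConradDiamondTaylor1999, Thm. 7.2.4 with Thm. 7.1.2 (proof, pp. 551–556)] -/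
theorem CDT_theorem_7_2_4_holds_of_leaves :
    CDT_theorem_7_2_1 → CDT_theorem_7_2_2 → CDT_lemma_7_2_3_isModular → CDT_three_five_switch →
      CDT_theorem_7_2_4 :=
  CDT_theorem_7_2_4_of_CDT721_722_723_switch

end Literature.NumberTheory.Automorphic.BCDT
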